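import Summits.Ventures.HSemireg.Mod4CarrierTopForm
import Summits.Ventures.HSemireg.Mod4MiddleDegree
import Summits.Ventures.HSemireg.Mod4MiddleMatrixAlt
import Summits.Ventures.HSemireg.WedgeWeilPurityBlockForms

/-!
# Venture HSemireg — MOD-4 line: THEOREM R_f's MIDDLE DEGREE ON THE p4 CARRIER, with the eigen-parameter READ OFF THE CARRIER
# (exact transport of `Mod4Site.middle_degree_rank`; the «sign pin» of MOD4-OFFSPLIT §10.1 as a kernel identity)

HONEST FRAMING. Part of the Lean index of the computation cell `pub-hsemireg` (widening group W3, seat w3-mod4-1 gen 6; file of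
record `HOME/widen/W3/MOD4-OFFSPLIT-w3mod4.md` §12).  Finite-dimensional exterior algebra over a field ONLY: th-7's sign-free wedge
model (`Wedge*.lean`) and p4's CARRIER (`WedgeCarrier*.lean`, `WedgeWeilCarrier.lean`: a `K`-space `V` with an adapted basis
`bV : Fin (2n + 2n) → V`, `ℓ_a := bV a`, `m_a := bV (2n + a)`, `L := span ℓ`; `Ecl q (2n) = Σ_m q_m Θ^m/m!`, `Θ = Σ_a ℓ_a ∧ m_a`;
`wUp n = ℓ_n⋯ℓ_{2n-1} m_{n-1}⋯m_0`, `wLow n = ℓ_0⋯ℓ_{n-1} m_{2n-1}⋯m_n`; `S_k(x) = ρ(⋀^k(L × Ann L))·x` the degree-`k` contraction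
span, `S_2 =` the tree's `ContractionSpan.span`).  No abelian variety, no sheaf, no Ext group, no semiregularity map is constructed;
nothing here says that HC, HC_CM or HC_AV holds; no Literature fact is declared or used.  The identification of a geometric class on
a Weil-type abelian `2n`-fold with `(q; a, b)` in an adapted Weil frame (`V = H¹`, `L = H^{0,1}`, the blocks = the `K`-eigenspaces)
is NOT asserted in Lean (theory/FORMULA-N-th7.md PART B §L.3; MOD4-OFFSPLIT §1 / §10.1).
WHAT IS PROVED (proof-only; no definitions).  (1) EXACT `Ψ`-IMAGES of p4's block products (p4's `Ψ_up` / `Ψ_low` had `∃ unit`):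
`Ψ(x_p⋯x_{k-1}) = y_p⋯y_{k-1}` (th-7's `Yp`), `Ψ(y_p⋯y_{k-1}) = Xp`, hence in Weil type `(n,n)`
`Ψ(x_n⋯x_{2n-1}·y_n⋯y_{2n-1}) = (−1)^{n·n}·E_{Gm}` and `Ψ(x_0⋯x_{n-1}·y_0⋯y_{n-1}) = (−1)^{n·n}·E_{Dm}` (`Ψ_zUp`, `Ψ_zLow`; via
`Yp·Xp = (−1)^{m·m+C(m,2)}·Π(x_c∧y_c)` and th-7's `pp_n_eq` / `pp_zero_eq`).  (2) EXACT TRANSPORT (`finrank_S_eq_model_nn`, every degree `k`):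
`dim S_k(Ecl q (2n) + a·wUp + b·wLow) = rank(θ ↦ θ ∧ vW (2n) n q ((−1)^{n·n}a) b ∣ ⋀^k)` — the carrier's `(a, b)` is the model's
`((−1)^{n·n}a, b)` (p4's sign `(−1)^{(N−p)p}` of `Φ_low` and the unit `(−1)^{n·n}` of `Ψ_zLow` cancel on `b`).
(3) **THEOREM R_f's MIDDLE DEGREE ON THE CARRIER** (`finrank_S_weil_nn_middle`; every field, `n ≥ 1`, every `q`, `a, b ≠ 0`):
`dim S_n(Ecl q (2n) + a·wUp + b·wLow) + 2·r_n + dim ker(M_f(q̃) − (−1)ⁿab) = (r_n + 2)·C(2n,n)` (g5's `Mod4Site.middle_degree_rank`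
transported; primed version with `M_f(q)` by g5's `finrank_ker_middleM_alt`), and **THE SIGN PIN AS A KERNEL IDENTITY**
(`finrank_S_weil_nn_middle_of_top`): if `(a·wUp) ∧ (b·wLow) = t • LMprod (2n)` (`LMprod (2n) = Π_a(ℓ_a∧m_a) = Θ^{2n}/(2n)!`; by
`Mod4CarrierTopForm.smul_wUp_mul_smul_wLow` this `t` is `(−1)ⁿab`) then `dim S_n + 2·r_n + dim ker(M_f(q) − t) = (r_n + 2)·C(2n,n)`:
THE EIGEN-PARAMETER OF THE MIDDLE DEGREE IS THE RATIO OF THE TWO TOP FORMS `(a w₊)∧(b w₋)` AND `Θ^{2n}/(2n)!` ON THE CARRIER — in the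
geometric dictionary `t = ∫(a w₊)∧(b w₋) / ∫Θ^{2n}/(2n)! = ∫w∧w/(2D) = (−1)ⁿ(w,w)_χ/(2D) = (−1)ⁿτ`, which is MOD4-OFFSPLIT's pin
`αβ = (−1)ⁿτ` (§10.2 / proof sheet §5), now without LEMMA U or the two-slope consistency argument.  (4) Weil type `(2,2)` for the
TREE's `ContractionSpan.span ↑L ↑(Ann L) x` literally (`finrank_contractionSpan_weil_22_middle`; the BF degree `HT²` of a fourfold
frame is its middle degree; `t = ab` there).  WHAT REMAINS NON-LEAN of THEOREM R_f as used geometrically: only the adapted-Weil-frame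
identification (the same residual as the side degrees, `WeilCarrier.finrank_S_weil_nn_deg`) and the reading of `∫` on `Λ^{4n}H¹`.
All statements and proofs: w3-mod4-1 g6 (2026-08-23).  Namespace `Summit.Ventures.HSemireg.Mod4Carrier`.
References: [BourbakiAlgebre1a3] Ch. III §7, §11 no. 9; [BuchweitzFlenner2008HH] Prop. 6.4.4 (why these operators).
-/

open Module

namespace Summit.Ventures.HSemireg.Mod4Carrier

open Summit.Ventures.HSemireg.WedgeBridge Summit.Ventures.HSemireg.WedgeC15 Summit.Ventures.HSemireg.WeilCarrier
open Summit.Ventures.HSemireg.Wedge Summit.Ventures.HSemireg.Wedge.Hankel Summit.Ventures.HSemireg.Wedge.Weil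
open Summit.Ventures.HSemireg.Wedge.WeilPurity (Xp Yp pp r r_mul_r Xp_mul_Yp X_mul_Yp)
open Summit.Ventures.HSemireg.Mod4 Summit.Ventures.HSemireg.Mod4Site
open ExteriorAlgebra (ι)

variable {K : Type*} [Field K] {n : ℕ}

/-! ### 1. Model side: `y`-run times `x`-run on one block -/

/-- graded commutativity of the two runs on one block: `Xp s m' * Yp s m = (−1)^{m'm} • (Yp s m * Xp s m')`. -/
lemma Xp_mul_Yp_comm (s m : ℕ) : ∀ m' : ℕ,
    Xp K n s m' * Yp K n s m = ((-1 : K) ^ (m' * m)) • (Yp K n s m * Xp K n s m')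
  | 0 => by rw [Xp, one_mul, mul_one, zero_mul, pow_zero, one_smul]
  | m' + 1 => by
    rw [Xp, mul_assoc, X_mul_Yp, mul_smul_comm, ← mul_assoc, Xp_mul_Yp_comm s m m', smul_mul_assoc, smul_smul,
      mul_assoc, ← pow_add]
    congr 2
    ring

/-- **`(y_s ⋯ y_{s+m-1}) (x_s ⋯ x_{s+m-1}) = (−1)^{m·m}(−1)^{C(m,2)} · Π_c (x_c ∧ y_c)`** (th-7's `Xp_mul_Yp` reversed). -/
lemma Yp_mul_Xp (s m : ℕ) :
    Yp K n s m * Xp K n s m = ((-1 : K) ^ (m * m) * (-1 : K) ^ (m.choose 2)) • pp K n s m := by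
  have h := Xp_mul_Yp_comm (K := K) (n := n) s m m
  have hε : (-1 : K) ^ (m * m) * (-1 : K) ^ (m * m) = 1 := by
    rw [← pow_add, ← two_mul, pow_mul, neg_one_sq, one_pow]
  calc Yp K n s m * Xp K n s m = ((-1 : K) ^ (m * m) * (-1 : K) ^ (m * m)) • (Yp K n s m * Xp K n s m) := by
        rw [hε, one_smul]
    _ = ((-1 : K) ^ (m * m)) • (Xp K n s m * Yp K n s m) := by rw [mul_smul, ← h]
    _ = ((-1 : K) ^ (m * m) * (-1 : K) ^ (m.choose 2)) • pp K n s m := by rw [Xp_mul_Yp, smul_smul]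

/-! ### 2. Bridge side: EXACT `Ψ`-images of p4's block products (no unknown units) -/

section Bridge

variable {V : Type*} [AddCommGroup V] [Module K V] (bV : Basis (Fin ((n + n) + (n + n))) K V)

/-- `Ψ(x_p ⋯ x_{k-1}) = y_p ⋯ y_{k-1}` EXACTLY (th-7's `Yp p (k − p)`; `Ψ(x_c) = y_c`). -/
lemma Ψ_xprodFrom_eq (p : ℕ) : ∀ k : ℕ, Ψ bV (xprodFrom bV p k) = Yp K n p (k - p)
  | 0 => by rw [xprodFrom, map_one, Nat.zero_sub, Yp]
  | k + 1 => by
    by_cases h : p ≤ k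
    · rw [xprodFrom, if_pos h, map_mul, Ψ_xprodFrom_eq p k, Ψ_XN, show k + 1 - p = (k - p) + 1 by omega, Yp,
        show p + (k - p) = k by omega]
    · rw [xprodFrom, if_neg h, mul_one, Ψ_xprodFrom_eq p k, show k + 1 - p = k - p by omega]

/-- `Ψ(y_p ⋯ y_{k-1}) = x_p ⋯ x_{k-1}` EXACTLY (th-7's `Xp p (k − p)`; `Ψ(y_c) = x_c`). -/
lemma Ψ_yprodFrom_eq (p : ℕ) : ∀ k : ℕ, Ψ bV (yprodFrom bV p k) = Xp K n p (k - p)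
  | 0 => by rw [yprodFrom, map_one, Nat.zero_sub, Xp]
  | k + 1 => by
    by_cases h : p ≤ k
    · rw [yprodFrom, if_pos h, map_mul, Ψ_yprodFrom_eq p k, Ψ_YN, show k + 1 - p = (k - p) + 1 by omega, Xp,
        show p + (k - p) = k by omega]
    · rw [yprodFrom, if_neg h, mul_one, Ψ_yprodFrom_eq p k, show k + 1 - p = k - p by omega]

/-- `(−1)^{C(n,2)} · r = 1`. -/
lemma neg_one_pow_choose_mul_r : (-1 : K) ^ (n.choose 2) * r K n = 1 := r_mul_r K (n := n)

/-- **`Ψ(x_n ⋯ x_{2n-1} · y_n ⋯ y_{2n-1}) = (−1)^{n·n} · E_{Gm}` EXACTLY** (p4's `Ψ_up` with its unit computed). -/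
theorem Ψ_zUp : Ψ bV (xprodFrom bV n (n + n) * yprodFrom bV n (n + n)) =
    ((-1 : K) ^ (n * n)) • B K (In (n + n)) (Gm (n + n) n) := by
  rw [map_mul, Ψ_xprodFrom_eq, Ψ_yprodFrom_eq, Nat.add_sub_cancel, Yp_mul_Xp, pp_n_eq, smul_smul, mul_assoc,
    neg_one_pow_choose_mul_r, mul_one]

/-- **`Ψ(x_0 ⋯ x_{n-1} · y_0 ⋯ y_{n-1}) = (−1)^{n·n} · E_{Dm}` EXACTLY** (p4's `Ψ_low` with its unit computed). -/
theorem Ψ_zLow : Ψ bV (xprod bV n * yprod bV n) = ((-1 : K) ^ (n * n)) • B K (In (n + n)) (Dm (n + n) n) := by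
  rw [xprod_eq_xprodFrom, yprod_eq_yprodFrom, map_mul, Ψ_xprodFrom_eq, Ψ_yprodFrom_eq, Nat.sub_zero, Yp_mul_Xp,
    pp_zero_eq, smul_smul, mul_assoc, neg_one_pow_choose_mul_r, mul_one]

/-! ### 3. EXACT transport for Weil type `(n,n)`: the carrier class has the model rank of `vW q ((−1)^{n·n}a) b` -/

/-- **EXACT TRANSPORT (type `(n,n)`, every degree `k`).** `dim S_k(Ecl q (2n) + a·w₊ + b·w₋)` is the wedge-model rank of th-7's
`vW (2n) n q ((−1)^{n·n}·a) b` — p4's `finrank_S_eq_model` with the units of `Ψ_up` / `Ψ_low` and the sign of `Φ_low`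
((−1)^{n·n} each) made explicit. [cite: BourbakiAlgebre1a3, Ch. III §11 no. 9] -/
theorem finrank_S_eq_model_nn (q : ℕ → K) (a b : K) (k : ℕ) :
    Module.finrank K (S K (Lsp bV) k (Ecl bV q (n + n) + a • wUp bV n + b • wLow bV n)) =
      Module.finrank K (LinearMap.range
        (Wedge.Hankel.wedge K (n + n) k (vW K (n + n) n q ((-1 : K) ^ (n * n) * a) b))) := by
  set ε : K := (-1 : K) ^ (n * n) with hε
  have hεε : ε * ε = 1 := by rw [hε, ← pow_add, ← two_mul, pow_mul, neg_one_sq, one_pow]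
  let v' : ExteriorAlgebra K (W K (Lsp bV)) :=
    gw bV q (n + n) + a • (xprodFrom bV n (n + n) * yprodFrom bV n (n + n)) + (b * ε) • (xprod bV n * yprod bV n)
  have hn : n ≤ n + n := Nat.le_add_right n n
  have hΦ : WedgeBridge.Φ K (Lsp bV) (vacuum bV) v' = Ecl bV q (n + n) + a • wUp bV n + b • wLow bV n := by
    simp only [v', map_add, map_smul, Φ_gw, Φ_up bV hn, Φ_low bV hn, Nat.add_sub_cancel, smul_smul, ← hε, mul_assoc,
      hεε, mul_one]
  have hΨ : Ψ bV v' = vW K (n + n) n q (ε * a) b := by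
    simp only [v', map_add, map_smul, Ψ_gw, Ψ_zUp, Ψ_zLow, smul_smul, ← hε, vW]
    rw [mul_assoc, hεε, mul_one, mul_comm a ε]
  rw [← hΦ, finrank_S_eq_of_injective (Φ_vacuum_injective bV) k v', finrank_range_wedge_eq, hΨ]

/-! ### 4. THEOREM R_f's middle degree ON THE CARRIER, with the eigen-parameter read off the carrier -/

/-- **THEOREM R_f, MIDDLE DEGREE, ON THE p4 CARRIER** (Weil type `(n,n)`, every field, every `n ≥ 1`, every `q`, `a, b ≠ 0`):
`dim S_n(Ecl q (2n) + a·w₊ + b·w₋) + 2·r_n + dim ker(M_f(q̃) − (−1)ⁿab) = (r_n + 2)·C(2n,n)`, `r_n = rank H_n(q)`, `q̃_i = (−1)^i q_i`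
(g5's `Mod4Site.middle_degree_rank` transported EXACTLY: the model's `ab` is the carrier's `(−1)ⁿ·ab`).
[cite: BuchweitzFlenner2008HH, Prop. 6.4.4] -/
theorem finrank_S_weil_nn_middle (hn : 1 ≤ n) (q : ℕ → K) {a b : K} (ha : a ≠ 0) (hb : b ≠ 0) :
    Module.finrank K (S K (Lsp bV) n (Ecl bV q (n + n) + a • wUp bV n + b • wLow bV n)) +
        2 * (hankel1 K (n + n) n q).rank +
        Module.finrank K (LinearMap.ker (Matrix.toLin' (middleM n (fun i => (-1 : K) ^ i * q i)) -
          ((-1 : K) ^ n * (a * b)) • LinearMap.id)) =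
      ((hankel1 K (n + n) n q).rank + 2) * (n + n).choose n := by
  have ha' : (-1 : K) ^ (n * n) * a ≠ 0 := mul_ne_zero (pow_ne_zero _ (neg_ne_zero.mpr one_ne_zero)) ha
  have h := middle_degree_rank hn q ha' hb
  rw [Mod4Site.neg_one_pow_mul_self, mul_assoc] at h
  rw [finrank_S_eq_model_nn, Mod4Site.neg_one_pow_mul_self]
  exact h

/-- the same with THEOREM R_f's own matrix `M_f(q)` (g5's `finrank_ker_middleM_alt`: the alternating convention does not change
the kernel dimensions): `dim S_n + 2·r_n + dim ker(M_f(q) − (−1)ⁿab) = (r_n + 2)·C(2n,n)`. [cite: BuchweitzFlenner2008HH, Prop. 6.4.4] -/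
theorem finrank_S_weil_nn_middle' (hn : 1 ≤ n) (q : ℕ → K) {a b : K} (ha : a ≠ 0) (hb : b ≠ 0) :
    Module.finrank K (S K (Lsp bV) n (Ecl bV q (n + n) + a • wUp bV n + b • wLow bV n)) +
        2 * (hankel1 K (n + n) n q).rank +
        Module.finrank K (LinearMap.ker (Matrix.toLin' (middleM n q) - ((-1 : K) ^ n * (a * b)) • LinearMap.id)) =
      ((hankel1 K (n + n) n q).rank + 2) * (n + n).choose n := by
  rw [← finrank_ker_middleM_alt]
  exact finrank_S_weil_nn_middle bV hn q ha hb

/-- **THE SIGN PIN AS A KERNEL STATEMENT.** The eigen-parameter is READ OFF THE CARRIER: if `(a·w₊) ∧ (b·w₋) = t • Θ^{2n}/(2n)!`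
(`LMprod (2n) = (ℓ_{2n-1}∧m_{2n-1})⋯(ℓ_0∧m_0)`), then `dim S_n(Ecl q (2n) + a·w₊ + b·w₋) + 2·r_n + dim ker(M_f(q) − t) = (r_n + 2)·C(2n,n)`
— i.e. `R_n = (r_n + 2)C(2n,n) − 2r_n − dim ker(M_f − t)` with `t = ∫ w₊-part ∧ w₋-part / ∫ Θ^{2n}/(2n)!` (`= (−1)ⁿab`, `Mod4CarrierTopForm`).
[cite: BuchweitzFlenner2008HH, Prop. 6.4.4] -/
theorem finrank_S_weil_nn_middle_of_top (hn : 1 ≤ n) (q : ℕ → K) {a b t : K} (ha : a ≠ 0) (hb : b ≠ 0)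
    (ht : (a • wUp bV n) * (b • wLow bV n) = t • LMprod bV (n + n)) :
    Module.finrank K (S K (Lsp bV) n (Ecl bV q (n + n) + a • wUp bV n + b • wLow bV n)) +
        2 * (hankel1 K (n + n) n q).rank +
        Module.finrank K (LinearMap.ker (Matrix.toLin' (middleM n q) - t • LinearMap.id)) =
      ((hankel1 K (n + n) n q).rank + 2) * (n + n).choose n := by
  rw [eq_of_smul_wUp_mul_smul_wLow bV (Nat.le_add_right n n) ht]
  exact finrank_S_weil_nn_middle' bV hn q ha hb

end Bridge

/-! ### 5. Weil FOURFOLD type `(2,2)`: the middle degree IS the tree's `ContractionSpan.span` (degree 2) -/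

section Fourfold

variable {V : Type*} [AddCommGroup V] [Module K V] (bV : Basis (Fin ((2 + 2) + (2 + 2))) K V)

/-- **Weil type `(2,2)` (abelian-fourfold frame), stated for the TREE's `ContractionSpan.span ↑L ↑(Ann L) x` literally:**
`dim span + 2·r_2 + dim ker(M_f(q) − t) = 6·(r_2 + 2)` where `(a·w₊) ∧ (b·w₋) = t • Θ⁴/4!` (`t = ab`) — the BF degree `HT²`
of a Weil fourfold is its middle degree. [cite: BuchweitzFlenner2008HH, Prop. 6.4.4] [cite: BourbakiAlgebre1a3, Ch. III §11 no. 9] -/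
theorem finrank_contractionSpan_weil_22_middle (q : ℕ → K) {a b t : K} (ha : a ≠ 0) (hb : b ≠ 0)
    (ht : (a • wUp bV 2) * (b • wLow bV 2) = t • LMprod bV (2 + 2)) :
    Module.finrank K (Summit.Ventures.HSemireg.ContractionSpan.span (Lsp bV : Set V)
        ((Lsp bV).dualAnnihilator : Set (Module.Dual K V)) (Ecl bV q (2 + 2) + a • wUp bV 2 + b • wLow bV 2)) +
        2 * (hankel1 K (2 + 2) 2 q).rank +
        Module.finrank K (LinearMap.ker (Matrix.toLin' (middleM 2 q) - t • LinearMap.id)) =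
      ((hankel1 K (2 + 2) 2 q).rank + 2) * (2 + 2).choose 2 := by
  rw [← S_two_eq]
  exact finrank_S_weil_nn_middle_of_top bV (by norm_num) q ha hb ht

/-- in the fourfold frame the carrier's eigen-parameter is `t = ab` on the nose (`(−1)² = 1`). -/
theorem top_coefficient_22 (a b : K) : (a • wUp bV 2) * (b • wLow bV 2) = (a * b) • LMprod bV (2 + 2) := by
  rw [smul_wUp_mul_smul_wLow_nn bV a b, show ((-1 : K) ^ 2) = 1 by norm_num, one_mul]

end Fourfold

end Summit.Ventures.HSemireg.Mod4Carrier
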